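import Summits.AnomalousDissipation.AnomalousDissipation.Theorems.DenseLoudDesignerForces.Negative.KillShape

/-!
# Vocabulary and glue of the line `galilean-detuning-body-force-grid`
# for the crux `BaireTransfer.DenseLoudDesignerForces` (stmt-AnomalousDissipation-1143)

Definitions-only support file plus SORRY-FREE glue, so that the line's REGISTERED STUBS — landed one by
one as `--supports stmt-AnomalousDissipation-1143` files under `Theorems/` — and the lead's skeleton
(`Cruxes/DenseLoudDesignerForces/Lines/galilean-detuning-body-force-grid.lean`, not importable) speak about
the SAME declarations.  The crux's own objects are the landed `Negative.force` (the steady trigonometric-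
polynomial designer force `f_c`), `Negative.loudSet` (`LOUD_j(S,E,ε)`) and `Negative.IsWindow`
(`Theorems/DenseLoudDesignerForces/Negative/KillShape.lean`; `Negative.denseLoudDesignerForces_iff` is
`Iff.rfl`).  This file adds the Galilean vocabulary of the line:

* `sweptForce V F` — the force seen in the frame moving with the mean momentum `V`, `F (y + [tV])`;
* `boost V w`, `boostScalar V q` — the Galilean boost `V + w t (x - [tV])` and the transported pressure;
* `driftVel E_V n`, `driftPeriod E_V n` — the lattice-commensurate drift of energy `E_V` along `n ∈ ℤ³`
  (`T · V = n`, `driftPeriod_smul_driftVel`);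
* `goodDrifts S κ c₀` — drifts uniformly non-resonant with the stock `S` whose resonant sublattice
  `n^⊥ ∩ ℤ³` is well rounded (`λ₁² ≥ c₀‖n‖`);
* `sweptLoudSet S E_w ε E_V n j` — coefficient vectors whose SWEPT force carries, at some `ν < 1/(j+1)`, a
  momentum-free drift-periodic classical fluctuation with budgets `(E_w, ε)`.

and the glue: drift algebra, `boost_periodic`, the transport lemma `mem_loudSet_of_swept_witness` (a
drift-class witness is a crux witness, GIVEN Galilean covariance and the boost budgets), `isWindow_glue`, the
registered sub-goal `line_glue`, and the
CONDITIONAL composition `DenseLoudDesignerForces_of` whose four hypotheses are exactly the four registered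
stubs `stub_galileanCovariance`, `stub_boostBudgets`, `stub_goodDrift`, `stub_gridLoudness` of the skeleton
(`ledger skeleton check`, 2026-08-16) and whose conclusion is the crux BY NAME.  No facts are asserted here.

References: Frisch, *Turbulence* (1995) §5.2 (grid turbulence); the route file `Theses/BaireTransfer.lean`
(item 1143); the line card `Cruxes/DenseLoudDesignerForces/Lines/galilean-detuning-body-force-grid.md`.
-/

-- `Summit.<Summit>.<Problem>` is the tree's mandated summit-side namespace (CONVENTIONS §2); for this
-- single-conjunct summit the two coincide, so the duplicate is deliberate.
set_option linter.dupNamespace false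

noncomputable section

open scoped BigOperators Topology InnerProductSpace
open Filter Set Function MeasureTheory

namespace Summit.AnomalousDissipation.AnomalousDissipation.Theorems.DenseLoudDesignerForces.Galilean

open Literature.Analysis.FunctionSpaces Literature.Analysis.FluidPDE
open Summit.AnomalousDissipation.AnomalousDissipation.Theses.BaireTransfer
open Summit.AnomalousDissipation.AnomalousDissipation.Theorems.DenseLoudDesignerForces.Negative

/-- The flat unit torus `T³`. -/
local notation "𝕋³" => UnitAddTorus (Fin 3)
/-- Real velocity values. -/
local notation "ℝ³" => EuclideanSpace ℝ (Fin 3)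
/-- Complex Fourier coefficient values. -/
local notation "ℂ³" => EuclideanSpace ℂ (Fin 3)
/-- The frequency / drift lattice `ℤ³`. -/
local notation "ℤ³" => Fin 3 → ℤ

/-! ## §0 The crux through the landed vocabulary -/

/-- **The crux, restated** (definitional): `DenseLoudDesignerForces ↔ ∀ S₀ ∃ S ⊇ S₀ ∃ E ε, 0 < ε ∧ ∃ U,
IsWindow S E ε U` with the landed `Negative.IsWindow` / `Negative.loudSet` / `Negative.force`. [folklore] -/
theorem crux_iff :
    DenseLoudDesignerForces ↔
      ∀ S₀ : Finset ℤ³, ∃ S : Finset ℤ³, S₀ ⊆ S ∧ ∃ (E ε : ℝ), 0 < ε ∧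
        ∃ U : Set (↥S → ℂ³), IsWindow S E ε U :=
  denseLoudDesignerForces_iff

/-! ## §1 Galilean vocabulary: swept force, boost, lattice-commensurate drifts -/

/-- The SWEPT force seen in the frame moving with the mean momentum `V`:
`(sweptForce V F) t y = F (y + [tV])` — a travelling wave, time-periodic as soon as `T·V ∈ ℤ³`. [folklore] -/
def sweptForce (V : ℝ³) (F : 𝕋³ → ℝ³) : ℝ → 𝕋³ → ℝ³ :=
  fun t y => F (y + Torus.proj (t • V))

/-- The Galilean BOOST of a fluctuation `w` by the mean momentum `V`: `u t x = V + w t (x - [tV])`. [folklore] -/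
def boost (V : ℝ³) (w : ℝ → 𝕋³ → ℝ³) : ℝ → 𝕋³ → ℝ³ :=
  fun t x => V + w t (x - Torus.proj (t • V))

/-- The transported pressure `p t x = q t (x - [tV])`. [folklore] -/
def boostScalar (V : ℝ³) (q : ℝ → 𝕋³ → ℝ) : ℝ → 𝕋³ → ℝ :=
  fun t x => q t (x - Torus.proj (t • V))

/-- The drift VELOCITY attached to a lattice vector `n ≠ 0` and a drift energy `E_V`: speed `√E_V` along `n`.
[folklore] -/
def driftVel (EV : ℝ) (n : ℤ³) : ℝ³ :=
  (Real.sqrt EV / ‖Torus.latticeVec n‖) • Torus.latticeVec n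

/-- The drift PERIOD `T = ‖n‖/√E_V`, making the drift lattice-commensurate: `T · driftVel = n`. [folklore] -/
def driftPeriod (EV : ℝ) (n : ℤ³) : ℝ :=
  ‖Torus.latticeVec n‖ / Real.sqrt EV

/-- GOOD DRIFTS for the stock `S` with constants `κ, c₀ > 0`: `n ≠ 0`; every non-zero stock mode is UNIFORMLY
non-resonant, `|k·n| ≥ κ‖k‖‖n‖` (so its sweeping rate `2π|k·driftVel| ≥ 2πκ√E_V‖k‖` is `ν`-independent); and
the exactly resonant sublattice `n^⊥ ∩ ℤ³` (modes feeling no sweeping, damped by viscosity only) starts at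
`|k|² ≥ c₀‖n‖`, i.e. at viscous scales when `ν ≍ 1/‖n‖`.  A `Set`, not a predicate. [folklore] -/
def goodDrifts (S : Finset ℤ³) (κ c₀ : ℝ) : Set ℤ³ :=
  {n | n ≠ 0 ∧
    (∀ k ∈ S, k ≠ 0 → κ * (‖Torus.latticeVec k‖ * ‖Torus.latticeVec n‖) ≤
      |⟪Torus.latticeVec k, Torus.latticeVec n⟫_ℝ|) ∧
    (∀ k : ℤ³, k ≠ 0 → ⟪Torus.latticeVec k, Torus.latticeVec n⟫_ℝ = 0 →
      c₀ * ‖Torus.latticeVec n‖ ≤ ‖Torus.latticeVec k‖ ^ 2)}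

/-- The SWEPT LOUD SET of level `j` for the drift `n` with drift energy `E_V`: coefficient vectors `c` whose
swept force `f_c(· + [t·driftVel])` carries, at SOME `ν ∈ (0, 1/(j+1))`, a MOMENTUM-FREE classical solution
`(w, q)` on `ℝ × T³`, periodic with the drift period, with fluctuation budgets `meanEnergy w ≤ E_w`,
`meanDissipation ν w ≥ ε` (the drift-class witnesses of the line, read in the swept frame). [folklore] -/
def sweptLoudSet (S : Finset ℤ³) (Ew ε EV : ℝ) (n : ℤ³) (j : ℕ) : Set (↥S → ℂ³) :=
  {c | ∃ ν : ℝ, 0 < ν ∧ ν < 1 / ((j : ℝ) + 1) ∧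
    ∃ (w : ℝ → 𝕋³ → ℝ³) (q : ℝ → 𝕋³ → ℝ),
      Torus.IsClassicalNSSolutionOn Set.univ ν (sweptForce (driftVel EV n) (force S c)) w q ∧
      Function.Periodic w (driftPeriod EV n) ∧ (∀ t, Torus.HasZeroMean (w t)) ∧
      meanEnergy w ≤ Ew ∧ ε ≤ meanDissipation ν w}

/-! ## §2 Drift algebra and periodicity of boosts (sorry-free) -/

/-- A non-zero lattice vector has a non-zero real image. [folklore] -/
theorem latticeVec_ne_zero {n : ℤ³} (hn : n ≠ 0) : Torus.latticeVec n ≠ 0 := by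
  intro h
  apply hn
  funext i
  have hi := congrArg (fun v : ℝ³ => v i) h
  simp only [Torus.latticeVec_apply, PiLp.zero_apply] at hi
  exact_mod_cast hi

/-- … hence positive norm. [folklore] -/
theorem norm_latticeVec_pos {n : ℤ³} (hn : n ≠ 0) : 0 < ‖Torus.latticeVec n‖ :=
  norm_pos_iff.2 (latticeVec_ne_zero hn)

/-- The drift period is positive. [folklore] -/
theorem driftPeriod_pos {EV : ℝ} (hEV : 0 < EV) {n : ℤ³} (hn : n ≠ 0) : 0 < driftPeriod EV n :=
  div_pos (norm_latticeVec_pos hn) (Real.sqrt_pos.2 hEV)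

/-- **Lattice commensurability of the drift**: `T · V = n`. [folklore] -/
theorem driftPeriod_smul_driftVel {EV : ℝ} (hEV : 0 < EV) {n : ℤ³} (hn : n ≠ 0) :
    driftPeriod EV n • driftVel EV n = Torus.latticeVec n := by
  have h1 : (0 : ℝ) < ‖Torus.latticeVec n‖ := norm_latticeVec_pos hn
  have h2 : (0 : ℝ) < Real.sqrt EV := Real.sqrt_pos.2 hEV
  have h3 : driftPeriod EV n * (Real.sqrt EV / ‖Torus.latticeVec n‖) = 1 := by
    rw [driftPeriod, div_mul_div_comm, mul_comm ‖Torus.latticeVec n‖ (Real.sqrt EV)]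
    exact div_self (mul_pos h2 h1).ne'
  rw [driftVel, smul_smul, h3, one_smul]

/-- The drift speed is `√E_V`. [folklore] -/
theorem norm_driftVel {EV : ℝ} {n : ℤ³} (hn : n ≠ 0) : ‖driftVel EV n‖ = Real.sqrt EV := by
  have h1 : (0 : ℝ) < ‖Torus.latticeVec n‖ := norm_latticeVec_pos hn
  rw [driftVel, norm_smul, norm_div, Real.norm_of_nonneg (Real.sqrt_nonneg _), Real.norm_of_nonneg h1.le,
    div_mul_cancel₀ _ h1.ne']

/-- The drift kinetic energy is `E_V`. [folklore] -/
theorem norm_driftVel_sq {EV : ℝ} (hEV : 0 ≤ EV) {n : ℤ³} (hn : n ≠ 0) : ‖driftVel EV n‖ ^ 2 = EV := by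
  rw [norm_driftVel hn, Real.sq_sqrt hEV]

/-- **Periodicity of boosts**: for a lattice-commensurate drift, `T·V = n ∈ ℤ³`, the boost of a `T`-periodic
fluctuation is `T`-periodic — the one-parameter subgroup generated by a lattice vector is CLOSED in `T³`
(`Torus.proj_latticeVec`). [folklore] -/
theorem boost_periodic {V : ℝ³} {n : ℤ³} {T : ℝ} (hTV : T • V = Torus.latticeVec n) {w : ℝ → 𝕋³ → ℝ³}
    (hper : Function.Periodic w T) : Function.Periodic (boost V w) T := by
  intro t
  funext x
  simp only [boost]
  rw [hper t, add_smul, Torus.proj_add, hTV, Torus.proj_latticeVec, add_zero]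

/-! ## §3 Transport of drift-class witnesses and the composition (sorry-free; stubs as hypotheses)

The four registered stubs of the line (lead's skeleton, `ledger skeleton check` 2026-08-16) are exactly the
four hypotheses of `DenseLoudDesignerForces_of` below, each to be landed as its own `--supports` file:
`stub_galileanCovariance` (a classical solution of the swept problem boosts to a classical solution of the
steadily forced problem), `stub_boostBudgets` (`meanEnergy (boost V w) = ‖V‖² + meanEnergy w`,
`meanDissipation ν (boost V w) = meanDissipation ν w` for lattice-commensurate drifts and momentum-free
periodic `w`), `stub_goodDrift` (good drifts at every scale) and `stub_gridLoudness` (the residual: swept loud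
sets are dense in a window, for every good drift at a level-dependent scale). -/

/-- **Transport of a drift-class witness**: GIVEN Galilean covariance and the boost budgets (the first two
stubs, taken as hypotheses), a momentum-free, drift-periodic classical solution of the swept problem with
fluctuation budgets `(E_w, ε)` puts `c` in `LOUD_j(S, E, ε)` for every `E ≥ E_V + E_w`, with the lab-frame
witness `boost (driftVel E_V n) w`. [folklore] -/
theorem mem_loudSet_of_swept_witness
    (hcov : ∀ (ν : ℝ) (V : ℝ³) (F : 𝕋³ → ℝ³) (w : ℝ → 𝕋³ → ℝ³) (q : ℝ → 𝕋³ → ℝ),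
      Torus.IsClassicalNSSolutionOn Set.univ ν (sweptForce V F) w q →
        Torus.IsClassicalNSSolutionOn Set.univ ν (fun _ => F) (boost V w) (boostScalar V q))
    (hbud : ∀ (ν : ℝ) (V : ℝ³) (n : ℤ³) (T : ℝ) (w : ℝ → 𝕋³ → ℝ³), 0 < T → T • V = Torus.latticeVec n →
      Torus.IsSmoothSpaceTimeOn Set.univ w → Function.Periodic w T → (∀ t, Torus.HasZeroMean (w t)) →
        meanEnergy (boost V w) = ‖V‖ ^ 2 + meanEnergy w ∧ meanDissipation ν (boost V w) = meanDissipation ν w)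
    {S : Finset ℤ³} {E Ew ε EV : ℝ} {n : ℤ³} {j : ℕ} {c : ↥S → ℂ³} (hEV : 0 < EV) (hn : n ≠ 0)
    (hE : EV + Ew ≤ E) (hc : c ∈ sweptLoudSet S Ew ε EV n j) : c ∈ loudSet S E ε j := by
  obtain ⟨ν, hν, hνj, w, q, hsol, hper, hmean, hEw, hεw⟩ := hc
  have hT : 0 < driftPeriod EV n := driftPeriod_pos hEV hn
  have hTV : driftPeriod EV n • driftVel EV n = Torus.latticeVec n := driftPeriod_smul_driftVel hEV hn
  obtain ⟨hEn, hDis⟩ :=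
    hbud ν (driftVel EV n) n (driftPeriod EV n) w hT hTV hsol.smooth_velocity hper hmean
  refine ⟨ν, hν, hνj, driftPeriod EV n, boost (driftVel EV n) w, boostScalar (driftVel EV n) q, hT,
    hcov ν (driftVel EV n) (force S c) w q hsol, boost_periodic hTV hper, ?_, ?_⟩
  · rw [hEn, norm_driftVel_sq hEV.le hn]
    linarith
  · rw [hDis]
    exact hεw

/-- **Window glue** (modular; its conclusion is deliberately the UNFOLDED crux in `Negative.IsWindow` shape).
Hypotheses: the TRANSPORT inclusion `sweptLoudSet ⊆ loudSet` (from the first two stubs via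
`mem_loudSet_of_swept_witness`), the good-drift statement and grid loudness.  Proof: for `S₀` take `S ⊇ S₀` from
grid loudness, `κ, c₀` from the good-drift statement for `S`, budgets `(E_V + E_w, ε)` and the window `U`; at level
`j` pick a good drift at scale `≥ N₀ j`, get density of the swept loud set in `U`, transport it into
`LOUD_j(S, E_V + E_w, ε)` by `closure_mono`. [folklore] -/
theorem isWindow_glue
    (htrans : ∀ (S : Finset ℤ³) (Ew ε EV : ℝ) (n : ℤ³) (j : ℕ), 0 < EV → n ≠ 0 →
      sweptLoudSet S Ew ε EV n j ⊆ loudSet S (EV + Ew) ε j)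
    (hdrift : ∀ S : Finset ℤ³, ∃ κ : ℝ, 0 < κ ∧ ∃ c₀ : ℝ, 0 < c₀ ∧
      ∀ N : ℕ, ∃ n : ℤ³, n ∈ goodDrifts S κ c₀ ∧ (N : ℝ) ≤ ‖Torus.latticeVec n‖)
    (hgrid : ∀ S₀ : Finset ℤ³, ∃ S : Finset ℤ³, S₀ ⊆ S ∧
      ∀ κ : ℝ, 0 < κ → ∀ c₀ : ℝ, 0 < c₀ →
        ∃ (EV Ew ε : ℝ), 0 < EV ∧ 0 < ε ∧ ∃ (N₀ : ℕ → ℕ) (U : Set (↥S → ℂ³)), IsOpen U ∧ U.Nonempty ∧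
          ∀ (j : ℕ) (n : ℤ³), n ∈ goodDrifts S κ c₀ → ((N₀ j : ℕ) : ℝ) ≤ ‖Torus.latticeVec n‖ →
            U ⊆ closure (sweptLoudSet S Ew ε EV n j)) :
    ∀ S₀ : Finset ℤ³, ∃ S : Finset ℤ³, S₀ ⊆ S ∧ ∃ (E ε : ℝ), 0 < ε ∧
      ∃ U : Set (↥S → ℂ³), IsWindow S E ε U := by
  intro S₀
  obtain ⟨S, hS, hgridS⟩ := hgrid S₀
  obtain ⟨κ, hκ, c₀, hc₀, hgood⟩ := hdrift S
  obtain ⟨EV, Ew, ε, hEV, hε, N₀, U, hU, hUne, hdense⟩ := hgridS κ hκ c₀ hc₀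
  refine ⟨S, hS, EV + Ew, ε, hε, U, ?_⟩
  show IsOpen U ∧ U.Nonempty ∧ ∀ j : ℕ, U ⊆ closure (loudSet S (EV + Ew) ε j)
  refine ⟨hU, hUne, fun j => ?_⟩
  obtain ⟨n, hgoodn, hnN⟩ := hgood (N₀ j)
  exact (hdense j n hgoodn hnN).trans (closure_mono (htrans S Ew ε EV n j hEV hgoodn.1))

/-- **Line glue** (the registered sub-goal `line_glue` of stmt-AnomalousDissipation-1143; one line so that its
signature is registrable verbatim): transport inclusion + good drifts + grid loudness imply the crux BY NAME
(`isWindow_glue` + `Negative.denseLoudDesignerForces_iff`). [folklore] -/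
theorem line_glue : (∀ (S : Finset ℤ³) (Ew ε EV : ℝ) (n : ℤ³) (j : ℕ), 0 < EV → n ≠ 0 → sweptLoudSet S Ew ε EV n j ⊆ loudSet S (EV + Ew) ε j) → (∀ S : Finset ℤ³, ∃ κ : ℝ, 0 < κ ∧ ∃ c₀ : ℝ, 0 < c₀ ∧ ∀ N : ℕ, ∃ n : ℤ³, n ∈ goodDrifts S κ c₀ ∧ (N : ℝ) ≤ ‖Torus.latticeVec n‖) → (∀ S₀ : Finset ℤ³, ∃ S : Finset ℤ³, S₀ ⊆ S ∧ ∀ κ : ℝ, 0 < κ → ∀ c₀ : ℝ, 0 < c₀ → ∃ (EV Ew ε : ℝ), 0 < EV ∧ 0 < ε ∧ ∃ (N₀ : ℕ → ℕ) (U : Set (↥S → ℂ³)), IsOpen U ∧ U.Nonempty ∧ ∀ (j : ℕ) (n : ℤ³), n ∈ goodDrifts S κ c₀ → ((N₀ j : ℕ) : ℝ) ≤ ‖Torus.latticeVec n‖ → U ⊆ closure (sweptLoudSet S Ew ε EV n j)) → DenseLoudDesignerForces :=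
  fun htrans hdrift hgrid => denseLoudDesignerForces_iff.2 (isWindow_glue htrans hdrift hgrid)

/-- **Composition of the line (kernel-checked glue): the four registered stubs prove the crux BY NAME.**
A CONDITIONAL result — its hypotheses are, verbatim, the registered stubs `stub_galileanCovariance`,
`stub_boostBudgets`, `stub_goodDrift`, `stub_gridLoudness` of the skeleton; it credits the item only when all
four have landed (then the skeleton's `DenseLoudDesignerForces_of` is this theorem applied to them). [folklore] -/
theorem DenseLoudDesignerForces_of
    (hcov : ∀ (ν : ℝ) (V : ℝ³) (F : 𝕋³ → ℝ³) (w : ℝ → 𝕋³ → ℝ³) (q : ℝ → 𝕋³ → ℝ),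
      Torus.IsClassicalNSSolutionOn Set.univ ν (sweptForce V F) w q →
        Torus.IsClassicalNSSolutionOn Set.univ ν (fun _ => F) (boost V w) (boostScalar V q))
    (hbud : ∀ (ν : ℝ) (V : ℝ³) (n : ℤ³) (T : ℝ) (w : ℝ → 𝕋³ → ℝ³), 0 < T → T • V = Torus.latticeVec n →
      Torus.IsSmoothSpaceTimeOn Set.univ w → Function.Periodic w T → (∀ t, Torus.HasZeroMean (w t)) →
        meanEnergy (boost V w) = ‖V‖ ^ 2 + meanEnergy w ∧ meanDissipation ν (boost V w) = meanDissipation ν w)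
    (hdrift : ∀ S : Finset ℤ³, ∃ κ : ℝ, 0 < κ ∧ ∃ c₀ : ℝ, 0 < c₀ ∧
      ∀ N : ℕ, ∃ n : ℤ³, n ∈ goodDrifts S κ c₀ ∧ (N : ℝ) ≤ ‖Torus.latticeVec n‖)
    (hgrid : ∀ S₀ : Finset ℤ³, ∃ S : Finset ℤ³, S₀ ⊆ S ∧
      ∀ κ : ℝ, 0 < κ → ∀ c₀ : ℝ, 0 < c₀ →
        ∃ (EV Ew ε : ℝ), 0 < EV ∧ 0 < ε ∧ ∃ (N₀ : ℕ → ℕ) (U : Set (↥S → ℂ³)), IsOpen U ∧ U.Nonempty ∧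
          ∀ (j : ℕ) (n : ℤ³), n ∈ goodDrifts S κ c₀ → ((N₀ j : ℕ) : ℝ) ≤ ‖Torus.latticeVec n‖ →
            U ⊆ closure (sweptLoudSet S Ew ε EV n j)) :
    DenseLoudDesignerForces :=
  line_glue (fun _ _ _ _ _ _ hEV hn _ hc => mem_loudSet_of_swept_witness hcov hbud hEV hn le_rfl hc)
    hdrift hgrid

end Summit.AnomalousDissipation.AnomalousDissipation.Theorems.DenseLoudDesignerForces.Galilean

end
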